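import Mathlib
import Summits.CriticalPhenomena.CardyFormulaZ2.Theorems.CardySelfRefinementDefs
import Summits.CriticalPhenomena.CardyFormulaZ2.Theorems.CardySelfRefinementRussoDriftModel
import Summits.CriticalPhenomena.CardyFormulaZ2.Theorems.CardySelfRefinementTrivialSectorRateStubSixArmDecayClusters
import Literature.Probability.Percolation.FourArmGarbanMonotone
import Literature.Probability.Percolation.ZdFourArmFromFiveArm
import Literature.Probability.Percolation.SelfRefinementMeasure
import HarnessLib

/-!
# Stub `stub_sixArmDecay` of line `far-field-is-a-quarter-turn` (crux `TrivialSectorRate`,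
stmt-CriticalPhenomena-10266): REDUCTION OF `SixArmDecayAlong` TO ITS TWO ARM-THEORETIC INPUTS

`SixArmDecayAlong k γ` asks `M_k(γ s)(sixArmThreeClustersAt c r R) ≤ C (r/R)^{2+ε}` uniformly in the
path parameter `s`, the centre `c` and `1 ≤ r ≤ R`.  In print (Bernoulli percolation) this is the
universal five-arm exponent `2`, UPPER half (Kesten–Sidoravicius–Zhang 1998; Nolin 2008, Thm. 23 (ii)
[EJP: Thm. 24 (ii)]: "at most one site can be a five-arm site with arms landing in prescribed areas",
`N² π₅' ≤ 1`, then arm separation `π₅ ≍ π₅'`), followed by Reimer's inequality for the sixth arm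
(`𝒜₆ ⊆ 𝒜₅ □ 𝒜₁`, `π₆ ≤ π₅ · π₁ ≤ C (r/R)^{2+α}`).  Neither half is in the tree, for the dependent
self-refinement model `M_k` along `PathOK` or even for bond-`ℤ²` at `½` (the tree has the five-arm
LOWER-bound chain `ZdFiveArm*`, `CentralFiveArm*` and the Reimer step `real_zdFiveArmClusters_le`).

This file isolates exactly what is missing, as two hypotheses over `M k (γ s).1 (γ s).2` in the
tree's vocabulary (`zdFiveArmClusters` recentred by `BondConfig.relabel (sym2Equiv (Site.shift (-c)))`,
as in `fourArmTwoClustersAt_eq_preimage`), and proves that they imply the stub's conclusion: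

* `sixArmDecayAlong_of_large_scales` — **range reduction**: a bound `C (m/n)^{2+ε}` for inner radii
  `m ≥ m₀` and ratios `n ≥ A m` only, uniformly in `s` and `c`, already gives `SixArmDecayAlong k γ`
  (small inner radii by the monotonicity `real_sixArmThreeClustersAt_mono`, bounded ratios free by
  `ratio_bound_of_large_ratio`);
* (S5) **five-arm upper bound along the path**: `M_k(γ s)(ω - c ∈ zdFiveArmClusters m n) ≤ C₅ (m/n)²`
  for `m₀ ≤ m ≤ n`, uniformly in `s`, `c`;
* (S6) **the sixth arm costs `(m/n)^δ` given five**: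
  `M_k(γ s)(sixArmThreeClustersAt c m n) ≤ C₆ (m/n)^δ · M_k(γ s)(ω - c ∈ zdFiveArmClusters m n)` for
  `m₀ ≤ m ≤ n`, some `δ > 0`, uniformly in `s`, `c` (Reimer/BK on the coin space after arm separation,
  and the one-arm decay of `M_k` from the box-crossing bounds of `PathOK`);
* `sixArmDecayAlong_of_fiveArm` — **(S5) ∧ (S6) → `SixArmDecayAlong k γ`** (exponent `2 + δ`).
  Registered helper of the stub `stub_sixArmDecay`; so
  `stub_sixArmDecay k hk γ hγ = sixArmDecayAlong_of_fiveArm k γ (S5 …) (S6 …)` once (S5), (S6) are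
  proved for `k = 2, 3` and admissible `γ`;
* `real_preimage_zdFiveArmClusters_apply_one` — at the endpoint `γ 1 = (0, ½)` the event of (S5) has
  probability `P_{1/2}(zdFiveArmClusters m n)`: even there (S5) is the bond-`ℤ²` five-arm upper bound,
  absent from the tree.

Target file:
`Summits/CriticalPhenomena/CardyFormulaZ2/Theorems/CardySelfRefinementTrivialSectorRateStubSixArmDecayReduction.lean`.
-/

noncomputable section


namespace Summit.CriticalPhenomena.CardyFormulaZ2.Theorems.CardySelfRefinement.FarField

open Set MeasureTheory
open Literature.Probability.LatticeModels Literature.Probability.Percolation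
open Literature.Probability.Percolation.QuadCrossing
open Summit.CriticalPhenomena.CardyFormulaZ2.Theses.CardySelfRefinement

-- adapted from …TrivialSectorRateStubFourArmAboveOneReduction.lean (`fourArmAboveOneAlong_of_garbanScheme`,
-- steps 2–3: small inner radii by monotonicity, bounded ratios free), with a ratio threshold `A`
/-- **Range reduction for `SixArmDecayAlong`.**  If along the path the six-arm probability satisfies
`M_k(γ s)(sixArmThreeClustersAt c m n) ≤ C (m/n)^{2+ε}` for all inner radii `m ≥ m₀` and all outer
radii `n ≥ A m` (some `ε > 0`, `A ≥ 1`), uniformly in `s` and `c`, then `SixArmDecayAlong k γ` (all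
`1 ≤ r ≤ R`, exponent `2 + ε`): inner radii `r < m₀` are raised to `max m₀ 1` by
`real_sixArmThreeClustersAt_mono` at the cost of the factor `(max m₀ 1)^{2+ε}`, and the ratios
`R < A (max m₀ 1) r` are free because probabilities are `≤ 1` (`ratio_bound_of_large_ratio`). -/
theorem sixArmDecayAlong_of_large_scales (k : ℕ) (γ : unitInterval → ℝ × ℝ)
    (h : ∃ ε C : ℝ, 0 < ε ∧ ∃ m₀ A : ℕ, 1 ≤ A ∧ ∀ (s : unitInterval) (c : Site 2) (m n : ℕ),
      m₀ ≤ m → A * m ≤ n →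
        (M k (γ s).1 (γ s).2).real (sixArmThreeClustersAt c m n) ≤ C * ((m : ℝ) / n) ^ (2 + ε)) :
    SixArmDecayAlong k γ := by
  obtain ⟨ε, C, hε, m₀, A, hA, h⟩ := h
  have hκ : (0 : ℝ) ≤ 2 + ε := by linarith
  -- a nonnegative constant
  set D : ℝ := max C 0 with hD
  have hD0 : 0 ≤ D := le_max_right _ _
  -- the threshold on the inner radius and on the ratio
  set m₁ : ℕ := max m₀ 1 with hm₁def
  have hm₁0' : m₀ ≤ m₁ := le_max_left _ _
  have hm₁1 : 1 ≤ m₁ := le_max_right _ _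
  have hm₁0 : (0 : ℝ) < m₁ := by exact_mod_cast hm₁1
  have hcore : ∀ (s : unitInterval) (c : Site 2) (m n : ℕ), m₁ ≤ m → A * m ≤ n →
      (M k (γ s).1 (γ s).2).real (sixArmThreeClustersAt c m n) ≤ D * ((m : ℝ) / n) ^ (2 + ε) := by
    intro s c m n hm hn
    have hm0 : (0 : ℝ) ≤ (m : ℝ) / n := by positivity
    exact (h s c m n (hm₁0'.trans hm) hn).trans
      (mul_le_mul_of_nonneg_right (le_max_left _ _) (Real.rpow_nonneg hm0 _))
  -- large ratio `A m₁ m ≤ n` for every `1 ≤ m` (small inner radii by monotonicity)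
  set c₂ : ℝ := D * (m₁ : ℝ) ^ (2 + ε) with hc₂
  have hlarge : ∀ (s : unitInterval) (c : Site 2) (m n : ℕ), 1 ≤ m → ((A * m₁ : ℕ) : ℝ) * m ≤ n →
      (M k (γ s).1 (γ s).2).real (sixArmThreeClustersAt c m n) ≤ c₂ * ((m : ℝ) / n) ^ (2 + ε) := by
    intro s c m n hm hn
    have hn' : A * m₁ * m ≤ n := by exact_mod_cast hn
    have hm0 : (0 : ℝ) < m := by exact_mod_cast hm
    have hK0 : (0 : ℝ) < ((A * m₁ : ℕ) : ℝ) := by exact_mod_cast Nat.mul_pos (by omega) (by omega)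
    have hn0 : (0 : ℝ) < n := lt_of_lt_of_le (mul_pos hK0 hm0) hn
    have hq0 : 0 < (m : ℝ) / n := div_pos hm0 hn0
    have hpow1 : ((m : ℝ) / n) ^ (2 + ε) ≤ (m₁ : ℝ) ^ (2 + ε) * ((m : ℝ) / n) ^ (2 + ε) :=
      le_mul_of_one_le_left (Real.rpow_nonneg hq0.le _)
        (Real.one_le_rpow (by exact_mod_cast hm₁1) hκ)
    by_cases hmm₁ : m₁ ≤ m
    · have hAm : A * m ≤ n :=
        le_trans (Nat.mul_le_mul_right m (Nat.le_mul_of_pos_right A (by omega))) hn'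
      calc (M k (γ s).1 (γ s).2).real (sixArmThreeClustersAt c m n) ≤ D * ((m : ℝ) / n) ^ (2 + ε) :=
            hcore s c m n hmm₁ hAm
        _ ≤ D * ((m₁ : ℝ) ^ (2 + ε) * ((m : ℝ) / n) ^ (2 + ε)) := mul_le_mul_of_nonneg_left hpow1 hD0
        _ = c₂ * ((m : ℝ) / n) ^ (2 + ε) := by rw [hc₂]; ring
    · have hlt : m ≤ m₁ := (not_le.1 hmm₁).le
      have hAm₁ : A * m₁ ≤ n := le_trans (Nat.le_mul_of_pos_right _ (by omega)) hn'
      have hm₁n : m₁ ≤ n := le_trans (Nat.le_mul_of_pos_left m₁ (by omega)) hAm₁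
      have hmono := real_sixArmThreeClustersAt_mono k (γ s).1 (γ s).2 c hlt hm₁n le_rfl
      have hq₁ : ((m₁ : ℝ) / n) ^ (2 + ε) ≤ (m₁ : ℝ) ^ (2 + ε) * ((m : ℝ) / n) ^ (2 + ε) := by
        rw [← Real.mul_rpow hm₁0.le hq0.le]
        refine Real.rpow_le_rpow (by positivity) ?_ hκ
        rw [mul_div_assoc', div_le_div_iff_of_pos_right hn0]
        have : (1 : ℝ) ≤ m := by exact_mod_cast hm
        nlinarith
      calc (M k (γ s).1 (γ s).2).real (sixArmThreeClustersAt c m n)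
          ≤ (M k (γ s).1 (γ s).2).real (sixArmThreeClustersAt c m₁ n) := hmono
        _ ≤ D * ((m₁ : ℝ) / n) ^ (2 + ε) := hcore s c m₁ n le_rfl hAm₁
        _ ≤ D * ((m₁ : ℝ) ^ (2 + ε) * ((m : ℝ) / n) ^ (2 + ε)) := mul_le_mul_of_nonneg_left hq₁ hD0
        _ = c₂ * ((m : ℝ) / n) ^ (2 + ε) := by rw [hc₂]; ring
  -- all `1 ≤ r ≤ R` (bounded ratios are free)
  have hK : (1 : ℝ) ≤ ((A * m₁ : ℕ) : ℝ) := by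
    exact_mod_cast (show 1 ≤ A * m₁ from le_trans hA (Nat.le_mul_of_pos_right A (by omega)))
  refine ⟨ε, max c₂ ((((A * m₁ : ℕ) : ℝ)) ^ (2 + ε)), hε, fun s c r R hr hrR => ?_⟩
  haveI := isProbabilityMeasure_M k (γ s).1 (γ s).2
  exact ratio_bound_of_large_ratio
    (f := fun m n => (M k (γ s).1 (γ s).2).real (sixArmThreeClustersAt c m n)) hκ hK
    (fun _ _ => measureReal_le_one) (fun m n hm hn => hlarge s c m n hm hn) r R hr hrR

/-- **Six arms above two along a path, from the five-arm upper bound and the price of the sixth arm**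
(registered helper of the stub `stub_sixArmDecay`).  If along the path
(S5) `M_k(γ s)(ω - c ∈ zdFiveArmClusters m n) ≤ C₅ (m/n)²` for `m₀ ≤ m ≤ n`, uniformly in `s` and the
centre `c` (universal five-arm exponent `2`, upper half), and
(S6) `M_k(γ s)(sixArmThreeClustersAt c m n) ≤ C₆ (m/n)^δ · M_k(γ s)(ω - c ∈ zdFiveArmClusters m n)` for
`m₀ ≤ m ≤ n` with some `δ > 0`, uniformly in `s`, `c` (the sixth arm), then `SixArmDecayAlong k γ`
holds with exponent `2 + δ`: for `m ≥ max m₀ m₀'` the two bounds multiply, and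
`sixArmDecayAlong_of_large_scales` removes the restriction on the radii. -/
theorem sixArmDecayAlong_of_fiveArm (k : ℕ) (γ : unitInterval → ℝ × ℝ)
    (h₅ : ∃ C₅ : ℝ, ∃ m₀ : ℕ, ∀ (s : unitInterval) (c : Site 2) (m n : ℕ), m₀ ≤ m → m ≤ n →
      (M k (γ s).1 (γ s).2).real
          (BondConfig.relabel (sym2Equiv (Site.shift (-c))) ⁻¹' zdFiveArmClusters m n) ≤
        C₅ * ((m : ℝ) / n) ^ 2)
    (h₆ : ∃ δ C₆ : ℝ, 0 < δ ∧ ∃ m₀ : ℕ, ∀ (s : unitInterval) (c : Site 2) (m n : ℕ), m₀ ≤ m → m ≤ n →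
      (M k (γ s).1 (γ s).2).real (sixArmThreeClustersAt c m n) ≤
        C₆ * ((m : ℝ) / n) ^ δ *
          (M k (γ s).1 (γ s).2).real
            (BondConfig.relabel (sym2Equiv (Site.shift (-c))) ⁻¹' zdFiveArmClusters m n)) :
    SixArmDecayAlong k γ := by
  obtain ⟨C₅, m₅, h₅⟩ := h₅
  obtain ⟨δ, C₆, hδ, m₆, h₆⟩ := h₆
  -- nonnegative constants
  set D₅ : ℝ := max C₅ 0 with hD₅
  set D₆ : ℝ := max C₆ 0 with hD₆
  have hD₅0 : 0 ≤ D₅ := le_max_right _ _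
  have hD₆0 : 0 ≤ D₆ := le_max_right _ _
  refine sixArmDecayAlong_of_large_scales k γ ⟨δ, D₆ * D₅, hδ, max (max m₅ m₆) 1, 1, le_rfl,
    fun s c m n hm hmn => ?_⟩
  rw [one_mul] at hmn
  have hm5 : m₅ ≤ m := ((le_max_left _ _).trans (le_max_left _ _)).trans hm
  have hm6 : m₆ ≤ m := ((le_max_right _ _).trans (le_max_left _ _)).trans hm
  have hm1 : 1 ≤ m := (le_max_right _ _).trans hm
  have hm0 : (0 : ℝ) < m := by exact_mod_cast hm1
  have hn0 : (0 : ℝ) < n := by exact_mod_cast (hm1.trans hmn)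
  set q : ℝ := (m : ℝ) / n with hq
  have hq0 : 0 < q := div_pos hm0 hn0
  have hqδ : 0 ≤ q ^ δ := (Real.rpow_pos_of_pos hq0 δ).le
  set P5 : ℝ := (M k (γ s).1 (γ s).2).real
    (BondConfig.relabel (sym2Equiv (Site.shift (-c))) ⁻¹' zdFiveArmClusters m n) with hP5
  have hP50 : 0 ≤ P5 := measureReal_nonneg
  have hfive : P5 ≤ D₅ * q ^ 2 :=
    (h₅ s c m n hm5 hmn).trans (mul_le_mul_of_nonneg_right (le_max_left _ _) (sq_nonneg _))
  have hsix : (M k (γ s).1 (γ s).2).real (sixArmThreeClustersAt c m n) ≤ D₆ * q ^ δ * P5 :=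
    (h₆ s c m n hm6 hmn).trans
      (mul_le_mul_of_nonneg_right (mul_le_mul_of_nonneg_right (le_max_left _ _) hqδ) hP50)
  have hpow : q ^ (2 + δ) = q ^ 2 * q ^ δ := by
    rw [Real.rpow_add hq0, Real.rpow_two]
  calc (M k (γ s).1 (γ s).2).real (sixArmThreeClustersAt c m n) ≤ D₆ * q ^ δ * P5 := hsix
    _ ≤ D₆ * q ^ δ * (D₅ * q ^ 2) := mul_le_mul_of_nonneg_left hfive (mul_nonneg hD₆0 hqδ)
    _ = D₆ * D₅ * q ^ (2 + δ) := by rw [hpow]; ring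

/-- **The five-arm input (S5) at the endpoint `γ 1 = (0, ½)`**: there the model is critical
bond-`ℤ²` (`M_apply_one_eq_bondPercolation`) and, by translation invariance
(`bondPercolation_real_preimage_shift`), the recentred five-arm event of (S5) has probability
`P_{1/2}(zdFiveArmClusters m n)` at every centre — so already at the endpoint (S5) is the bond-`ℤ²`
five-arm upper bound `P_{1/2}(zdFiveArmClusters m n) ≤ C (m/n)²` (Nolin 2008, Thm. 23 (ii), upper
half), which the tree does not have. -/
theorem real_preimage_zdFiveArmClusters_apply_one {k : ℕ} {γ : unitInterval → ℝ × ℝ} (hγ : PathOK k γ)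
    (c : Site 2) (m n : ℕ) :
    (M k (γ 1).1 (γ 1).2).real
        (BondConfig.relabel (sym2Equiv (Site.shift (-c))) ⁻¹' zdFiveArmClusters m n) =
      (bondPercolation (zdGraph 2) half).real (zdFiveArmClusters m n) := by
  rw [M_apply_one_eq_bondPercolation hγ, bondPercolation_real_preimage_shift]

end Summit.CriticalPhenomena.CardyFormulaZ2.Theorems.CardySelfRefinement.FarField

end
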